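import Literature.MathematicalPhysics.QuantumFieldTheory.Balaban1983to89.Node00.Record5C
import Literature.MathematicalPhysics.QuantumFieldTheory.Balaban1983to89.B13LeafTorus
import Literature.MathematicalPhysics.QuantumFieldTheory.Balaban1983to89.B13Lemma3TorusSocket

/-!
# `Balaban1983to89.B13NodeKnitRecord5C` — YM-DAG node N10 · [Balaban1988RG2Cluster] CMP **116** (1988) 1–22, Lemmas 1–3
# pp. 9, 11, 20: the N10 knit `Dag.B13_main` («b9 → b10 → b11 → b12 → b13») AT NODE 00's STAGE-5 RECORD PREDICATE OF RECORD
# `Node00.IsRecordOfRecord₅C F N D w` (C-binding, pub-ymgap chair R434 (Q2) = (C)) and at its literal-`b10` twin `IsRecordOfRecord₅`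
# — every leaf the node reads LOCATED AT THE RECORD'S RESIDUAL CARRIERS, the `S_N10 Rec₅C` shape, the torus pin, and the equality
# form of termwise domination (2.9)/(2.14)

statement-level bookkeeping over published theorems with citation tags; kernel-checked compositions of tree theorems;
nothing here is a claim about the Yang–Mills mass gap.

CITATION HEADER (lean-in-tree rule).  Source: T. Bałaban, *Renormalization group approach to lattice gauge field theories. II. Cluster
expansions*, Commun. Math. Phys. **116**, 1–22 (1988), doi:10.1007/bf01239022 [Balaban1988RG2Cluster] (cell paper B13 = «[II]»); the node's
in-edges are [13] = [Balaban1985BackgroundPropagators] (b9), [16] = [Balaban1985UV3] (b10), [15] = [Balaban1985Variational] (b11), [I] =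
[Balaban1987RG1] Sects. 2–5 (b12) — p. 1 and Lemma 3 p. 20 of the source.  Seat `pub-ymgap-dag-p2` = n10-a (YM-PLAN Track A, HUMAN RULING
D-0062: the KNIT-BY-NAME seat of node N10; chair R420 ∕ R422 ∕ R424; director-ym LINE №12), generation g4, module 1 of the generation (the
seat's earlier modules: `B13Lemma1*Torus*`, `B13LeafTorus`, `B13NodeTorus`, `B13NodeTorusConsts`, `B13NodeTorusTermwise` = the KNIT v2 p411918).
BY NAME and UNCHANGED: `…Node00.Record5C` (seat pub-ymgap-node00-def g28: `IsRecordOfRecord₅C`, `upOfRecord₅C`; with `…Node00.Record5`: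
`IsRecordOfRecord₅`, `Stage5Params`, `Residual₅`, `datumOfRecord₅`, `upOfRecord₅`, `carriers₃`), `…B10CompactBinding` (`ofPrintedAllXPNC`,
`DagDischarged.b10Compact`), `…DagBinding` (`leavesP`, `WorldP`, `B9LeafX`, `B11Leaf`, `Upstream.ofPrintedAllXPN`), `…Dag` (`B13_main` :218),
`…B13` (`Lemma1Printed` :355, `Lemma2Printed` :381, `Lemma3Printed` :397), `…B13Lemma3Torus` (`TwoTorusStep`, `toStepData`),
`…B13Lemma3TorusSocket` (`TermDomination`), `…B13Lemma3TorusTerms` (`terms`).  Pattern of the file: n11-a's `B14NodeKnitRecord5` and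
n13-a's `B16NodeKnitRecord5` ∕ `B16NodeKnitRecord5C` (the N11 ∕ N13 knits at the same record).

WHAT THE STAGE-5 RECORD PINS FOR N10 AND WHAT IT LEAVES.  At a record `(D, w)` with parameters `θ : Node00.Stage5Params F N` every run's
upstream block is the C-binding of record `w.up P = upOfRecord₅C θ P = ofPrintedAllXPNC (carriers₃ θ (θ.res.X P)) (θ.res.Y P) (θ.res.Z P)
(θ.res.V P) (θ.res.W P)` (`Node00.upOfRecord₅C_eq`).  The node `Dag.B13_main (leavesP w P)` reads ONLY leaves of `w.up P` (not `w.C`, not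
`w.γ`), and the Stage 1–3 substitutions `carriers₁ ∕ ₂ ∕ ₃` touch the B4 ∕ B5 ∕ B6 ∕ B7 groups only (`Node00.CarriersFrame.carriers₁_groupB13`:
the B13 group is FREE), so at the record, definitionally (`Iff.rfl`, §1):
* the leaf `b13` IS the B13 triple `Lemma1Printed ∧ Lemma2Printed ∧ Lemma3Printed` of the RESIDUAL group `((θ.res.X P).S13, (θ.res.X P).c13)` —
  free data of `Residual₅` (NODE 00 Stages ≥ 6 replace the residual carrier bundle by constructed objects; seat node00-def);
* the in-edges read `b9 = B9LeafX (θ.res.Y P)` ([13] Thms 3.1–3.15 over the residual B9 carriers), `b10 = B10.Thm1PrintedCompact (θ.res.X P).runs10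
  ∧ B10.Thm2Printed (θ.res.X P).runs10` ([16] in the COMPACT reading — the one slot where `₅C` differs from `₅`, whose `b10` is the LITERAL
  `B10.Thm1Printed ∧ Thm2Printed`), `b11 = B11Leaf (θ.res.Z P)` ([15]), `b12 = B12Sec2to5.Lemma4Printed (θ.res.X P).F12 (θ.res.X P).c12` ([I] Lemma 4).
Hence over Stage 5 the N10 knit keeps ONE slot, displayed as a hypothesis on the residual fields: (B13₅) «at the parameters of the record and
the run, the in-edge leaves at the residual carriers imply the B13 triple of the residual B13 group».  The seat's torus chain says how a pin
fills it: if a later stage sets `(θ.res.X P).S13 = Wt.toStepData`, `(θ.res.X P).c13 = c` for a two-scale torus step datum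
`Wt : B13Lemma3Torus.TwoTorusStep 4 L N′` carrying Bałaban's k-th step objects with the located per-term inputs, then
`B13NodeTorusTermwise.b13Leaf_twoTorus_termwise` (LEVEL T) ∕ `b13Leaf_twoTorus_primitives` (per-term primitives) IS the triple for
`Wt.toStepData` and §1's `b13_main_at_stage5ParamsC_twoTorus` closes the node at that run BY NAME (pin obligations:
`HOME/pub-ymgap-dag-p2/N10-PIN-LIST.md` v2).

WHAT THIS FILE PROVES (0 `sorry`, 0 `def`, standard axioms).
§0 `b13_main_iff_up`, `b13_main_of_b13` — the node at ANY world and run, binding-agnostic (`Iff.rfl`; the form every record predicate instantiates).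
§1 At the Stage-5 parameters `θ` (a run bound to `upOfRecord₅C θ P`, resp. `upOfRecord₅ θ P`): `b13_leaf_iff_res₅C`, `inEdges_iff_res₅C`,
   **`b13_main_iff_res₅C`** (the node unfolded at the record's residual carriers), `b13_main_at_stage5ParamsC` (N10 at `(w, P)` from the slot
   (B13₅)), **`b13_main_at_stage5ParamsC_twoTorus`** (N10 at `(w, P)` from a torus pin of the residual B13 group + the torus leaf triple, i.e.
   from p411918's conclusions by name); the literal twins `b13_main_iff_res₅`, `b13_main_at_stage5Params`, `b13_main_at_stage5Params_twoTorus`;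
   `b13_leaf_res₅C_eq_res₅` (the two bindings agree on everything N10 concludes; they differ in the antecedent `b10` only).
§2 **`b13_main_of_isRecordOfRecord₅C`** — THE KNIT AT THE RECORD PREDICATE OF RECORD (slot over the parameters of the record);
   **`b13_main_forall_isRecordOfRecord₅C`** — the `S_N10 Rec₅C` shape `∀ D w, IsRecordOfRecord₅C F N D w → ∀ P, Dag.B13_main (leavesP w P)` from
   the slot stated ONCE over all admissible `θ` (it reads neither `D` nor `w`: N10 is a statement about `θ.res` alone);
   `b13_main_forall_isRecordOfRecord₅C_twoTorus` (the same from a family of torus pins `Wt θ P` with their leaf triples); the `₅` twins.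
§3 `termDomination_of_repr` — the EQUALITY form of (2.9)/(2.14) («H(Z) = Σ over the terms (𝐃, P)», p. 14) implies
   `B13Lemma3TorusSocket.TermDomination` (the hypothesis `hH` of the knit v2) by `norm_sum_le` — for pins whose H(Z) IS the displayed sum.

HONEST FRAMING.  A count-neutral SLOT landing (R429 (4)(i)): N10 is NOT discharged — at Stage 5 the B13 group and the B9 ∕ B10 ∕ B11 ∕ B12
carriers the node reads are RESIDUAL FREE DATA, so the slot (B13₅) is a displayed hypothesis, not a theorem (over ALL residuals it would assert
Lemmas 1–3 for an arbitrary `B13.StepData`); it becomes statable in closed form once a later stage pins `θ.res.X P` (the torus pin of §1∕§2 is the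
seat's proposal for that stage, with the per-term analytic inputs of Lemmas 1–2, the NODE-O∕A primitive kernels with L17a∕L16a, termwise
domination, identifications and numbers as its content — `B13NodeTorusTermwise` docstring).  Definitions of record are node00-def's and unchanged;
no estimate, no satisfiability claim; Bałaban AS PRINTED with page locators; one finite T⁴ programme at fixed ε per run — NOT continuum ∕ ℝ⁴ ∕
infinite volume ∕ OS ∕ mass gap ∕ Clay.  No `sorry`, no new definition, no new named fact (D-0026).
-/

noncomputable section

namespace Literature.MathematicalPhysics.QuantumFieldTheory.Balaban1983to89.B13NodeKnitRecord5C

open DagBinding T4DatumAssembly T4Continuum Node00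
open Literature.MathematicalPhysics.QuantumFieldTheory.Balaban1983to89.TreeLengthTorus (TDom)
open Literature.MathematicalPhysics.QuantumFieldTheory.Balaban1983to89.B13Lemma3TorusData (TBond)
open Literature.MathematicalPhysics.QuantumFieldTheory.Balaban1983to89.B13Lemma3Torus (TwoTorusStep)
open Literature.MathematicalPhysics.QuantumFieldTheory.Balaban1983to89.B13Lemma3TorusTerms (terms)
open Literature.MathematicalPhysics.QuantumFieldTheory.Balaban1983to89.B13Lemma3TorusSocket (TermDomination)

/-! ## §0. The node at any world and run (binding-agnostic) -/

/-- **N10 at the `leavesP` binding, unfolded** (`Iff.rfl`): `Dag.B13_main (leavesP w P)` IS «b9 → b10 → b11 → b12 → b13» over the leaves of the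
run's upstream block `w.up P` — the node reads no other world letter. [cite: Balaban1988RG2Cluster, p.1 and Lemma 3 p.20 (the paper's inputs [13], [16], [15], [I]; bookkeeping)] -/
theorem b13_main_iff_up (w : WorldP) (P : B12.RunParams) :
    Dag.B13_main (leavesP w P) ↔ ((w.up P).b9 → (w.up P).b10 → (w.up P).b11 → (w.up P).b12 → (w.up P).b13) :=
  Iff.rfl

/-- N10 at any run from its own leaf `b13` (in-edges unused; bookkeeping). [cite: Balaban1988RG2Cluster, Lemmas 1–3 pp.9, 11, 20 (bookkeeping)] -/
theorem b13_main_of_b13 (w : WorldP) (P : B12.RunParams) (h : (w.up P).b13) : Dag.B13_main (leavesP w P) :=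
  fun _ _ _ _ => h

variable (F : T4Family) (N : ℕ) [NeZero N]

/-! ## §1. At the Stage-5 parameters `θ`: every leaf N10 reads, located at the residual carriers -/

section AtParams

variable (θ : Stage5Params F N) (w : WorldP) (P : B12.RunParams)

/-- **Leaf `b13` at a run bound to the C-binding of record** (`Iff.rfl`): the B13 triple of the RESIDUAL group `((θ.res.X P).S13, (θ.res.X P).c13)`
— the Stage 1–3 substitutions inside `carriers₃` and the `b10` update of `ofPrintedAllXPNC` do not touch the B13 group.
[cite: Balaban1988RG2Cluster, Lemma 1 p.9, Lemma 2 p.11, Lemma 3 p.20 (dictionary, bookkeeping)] -/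
theorem b13_leaf_iff_res₅C (hup : w.up P = upOfRecord₅C F N θ P) :
    (leavesP w P).b13 ↔
      B13.Lemma1Printed (θ.res.X P).S13 (θ.res.X P).c13 ∧ B13.Lemma2Printed (θ.res.X P).S13 (θ.res.X P).c13 ∧
        B13.Lemma3Printed (θ.res.X P).S13 (θ.res.X P).c13 := by
  show (w.up P).b13 ↔ _
  rw [hup]
  exact Iff.rfl

/-- **The in-edges of N10 at a run bound to the C-binding of record** (`Iff.rfl` ×4): `b9` = [13]'s extended leaf over the residual B9 carriers,
`b10` = [16] Thm 1 in the COMPACT reading ∧ Thm 2 over the residual run family, `b11` = [15]'s leaf over the residual B11 carriers, `b12` = [I]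
Lemma 4 (3.53) over the residual frame and constants. [cite: Balaban1988RG2Cluster, p.1 (references [13], [15], [16], [I]; dictionary, bookkeeping)] -/
theorem inEdges_iff_res₅C (hup : w.up P = upOfRecord₅C F N θ P) :
    ((leavesP w P).b9 ↔ B9LeafX (θ.res.Y P)) ∧
    ((leavesP w P).b10 ↔ B10.Thm1PrintedCompact (θ.res.X P).runs10 ∧ B10.Thm2Printed (θ.res.X P).runs10) ∧
    ((leavesP w P).b11 ↔ B11Leaf (θ.res.Z P)) ∧
    ((leavesP w P).b12 ↔ B12Sec2to5.Lemma4Printed (θ.res.X P).F12 (θ.res.X P).c12) := by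
  refine ⟨?_, ?_, ?_, ?_⟩
  · show (w.up P).b9 ↔ _
    rw [hup]
    exact Iff.rfl
  · show (w.up P).b10 ↔ _
    rw [hup]
    exact Iff.rfl
  · show (w.up P).b11 ↔ _
    rw [hup]
    exact Iff.rfl
  · show (w.up P).b12 ↔ _
    rw [hup]
    exact Iff.rfl

/-- **N10 UNFOLDED AT THE RECORD'S OBJECTS** (C-binding; `Iff.rfl`): at a run bound to `upOfRecord₅C θ P`, `Dag.B13_main (leavesP w P)` IS
«`B9LeafX (θ.res.Y P)` → ([16] Thm 1 compact ∧ Thm 2 over `(θ.res.X P).runs10`) → `B11Leaf (θ.res.Z P)` → [I] Lemma 4 over `(θ.res.X P).F12 ∕ c12` →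
Lemmas 1–3 for `((θ.res.X P).S13, (θ.res.X P).c13)`». [cite: Balaban1988RG2Cluster, Lemmas 1–3 pp.9, 11, 20; p.1 (in-edges)] -/
theorem b13_main_iff_res₅C (hup : w.up P = upOfRecord₅C F N θ P) :
    Dag.B13_main (leavesP w P) ↔
      (B9LeafX (θ.res.Y P) →
        (B10.Thm1PrintedCompact (θ.res.X P).runs10 ∧ B10.Thm2Printed (θ.res.X P).runs10) →
          B11Leaf (θ.res.Z P) → B12Sec2to5.Lemma4Printed (θ.res.X P).F12 (θ.res.X P).c12 →
            B13.Lemma1Printed (θ.res.X P).S13 (θ.res.X P).c13 ∧ B13.Lemma2Printed (θ.res.X P).S13 (θ.res.X P).c13 ∧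
              B13.Lemma3Printed (θ.res.X P).S13 (θ.res.X P).c13) := by
  show ((w.up P).b9 → (w.up P).b10 → (w.up P).b11 → (w.up P).b12 → (w.up P).b13) ↔ _
  rw [hup]
  exact Iff.rfl

/-- **N10 at the Stage-5 parameters of the record** (C-binding): from the slot (B13₅) «the in-edge leaves at the residual carriers imply the B13
triple of the residual group» the node holds at `(w, P)`. Count-neutral slot form. [cite: Balaban1988RG2Cluster, Lemmas 1–3 pp.9, 11, 20] -/
theorem b13_main_at_stage5ParamsC (hup : w.up P = upOfRecord₅C F N θ P)
    (slot : B9LeafX (θ.res.Y P) →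
      (B10.Thm1PrintedCompact (θ.res.X P).runs10 ∧ B10.Thm2Printed (θ.res.X P).runs10) →
        B11Leaf (θ.res.Z P) → B12Sec2to5.Lemma4Printed (θ.res.X P).F12 (θ.res.X P).c12 →
          B13.Lemma1Printed (θ.res.X P).S13 (θ.res.X P).c13 ∧ B13.Lemma2Printed (θ.res.X P).S13 (θ.res.X P).c13 ∧
            B13.Lemma3Printed (θ.res.X P).S13 (θ.res.X P).c13) :
    Dag.B13_main (leavesP w P) :=
  (b13_main_iff_res₅C F N θ w P hup).mpr slot

/-- **N10 at the Stage-5 parameters FROM A TORUS PIN** (C-binding): if the residual B13 group of the run IS the record of a two-scale torus step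
datum `Wt : TwoTorusStep 4 L N′` with constants `c` (`hS`, `hc` — what a later NODE-00 stage sets), and the in-edges at the residual carriers give
the leaf triple for `Wt.toStepData` (for instance by `B13NodeTorusTermwise.b13Leaf_twoTorus_termwise ∕ _primitives`, in-edges unused there), then
the node holds at `(w, P)`. [cite: Balaban1988RG2Cluster, Lemmas 1–3 pp.9, 11, 20] -/
theorem b13_main_at_stage5ParamsC_twoTorus (hup : w.up P = upOfRecord₅C F N θ P) {L N' : ℕ} [NeZero L] [NeZero N']
    (Wt : TwoTorusStep 4 L N') (c : B13.Consts) (hS : (θ.res.X P).S13 = Wt.toStepData) (hc : (θ.res.X P).c13 = c)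
    (hleaf : B9LeafX (θ.res.Y P) →
      (B10.Thm1PrintedCompact (θ.res.X P).runs10 ∧ B10.Thm2Printed (θ.res.X P).runs10) →
        B11Leaf (θ.res.Z P) → B12Sec2to5.Lemma4Printed (θ.res.X P).F12 (θ.res.X P).c12 →
          B13.Lemma1Printed Wt.toStepData c ∧ B13.Lemma2Printed Wt.toStepData c ∧ B13.Lemma3Printed Wt.toStepData c) :
    Dag.B13_main (leavesP w P) := by
  refine (b13_main_iff_res₅C F N θ w P hup).mpr fun h9 h10 h11 h12 => ?_
  rw [hS, hc]
  exact hleaf h9 h10 h11 h12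

/-- **N10 UNFOLDED AT THE RECORD'S OBJECTS, literal twin** (N-binding `upOfRecord₅`; `Iff.rfl`): as `b13_main_iff_res₅C` with the `b10` antecedent
in the LITERAL reading `B10.Thm1Printed ∧ B10.Thm2Printed` (the documented negative edge's record form, `Node00.Record5C` docstring).
[cite: Balaban1988RG2Cluster, Lemmas 1–3 pp.9, 11, 20; p.1 (in-edges)] -/
theorem b13_main_iff_res₅ (hup : w.up P = upOfRecord₅ F N θ P) :
    Dag.B13_main (leavesP w P) ↔
      (B9LeafX (θ.res.Y P) → (B10.Thm1Printed (θ.res.X P).runs10 ∧ B10.Thm2Printed (θ.res.X P).runs10) →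
        B11Leaf (θ.res.Z P) → B12Sec2to5.Lemma4Printed (θ.res.X P).F12 (θ.res.X P).c12 →
          B13.Lemma1Printed (θ.res.X P).S13 (θ.res.X P).c13 ∧ B13.Lemma2Printed (θ.res.X P).S13 (θ.res.X P).c13 ∧
            B13.Lemma3Printed (θ.res.X P).S13 (θ.res.X P).c13) := by
  show ((w.up P).b9 → (w.up P).b10 → (w.up P).b11 → (w.up P).b12 → (w.up P).b13) ↔ _
  rw [hup]
  exact Iff.rfl

/-- **N10 at the Stage-5 parameters, literal twin** (N-binding): from the slot with the literal `b10` antecedent. [cite: Balaban1988RG2Cluster, Lemmas 1–3 pp.9, 11, 20] -/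
theorem b13_main_at_stage5Params (hup : w.up P = upOfRecord₅ F N θ P)
    (slot : B9LeafX (θ.res.Y P) → (B10.Thm1Printed (θ.res.X P).runs10 ∧ B10.Thm2Printed (θ.res.X P).runs10) →
      B11Leaf (θ.res.Z P) → B12Sec2to5.Lemma4Printed (θ.res.X P).F12 (θ.res.X P).c12 →
        B13.Lemma1Printed (θ.res.X P).S13 (θ.res.X P).c13 ∧ B13.Lemma2Printed (θ.res.X P).S13 (θ.res.X P).c13 ∧
          B13.Lemma3Printed (θ.res.X P).S13 (θ.res.X P).c13) :
    Dag.B13_main (leavesP w P) :=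
  (b13_main_iff_res₅ F N θ w P hup).mpr slot

/-- **N10 at the Stage-5 parameters FROM A TORUS PIN, literal twin** (N-binding). [cite: Balaban1988RG2Cluster, Lemmas 1–3 pp.9, 11, 20] -/
theorem b13_main_at_stage5Params_twoTorus (hup : w.up P = upOfRecord₅ F N θ P) {L N' : ℕ} [NeZero L] [NeZero N']
    (Wt : TwoTorusStep 4 L N') (c : B13.Consts) (hS : (θ.res.X P).S13 = Wt.toStepData) (hc : (θ.res.X P).c13 = c)
    (hleaf : B9LeafX (θ.res.Y P) → (B10.Thm1Printed (θ.res.X P).runs10 ∧ B10.Thm2Printed (θ.res.X P).runs10) →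
      B11Leaf (θ.res.Z P) → B12Sec2to5.Lemma4Printed (θ.res.X P).F12 (θ.res.X P).c12 →
        B13.Lemma1Printed Wt.toStepData c ∧ B13.Lemma2Printed Wt.toStepData c ∧ B13.Lemma3Printed Wt.toStepData c) :
    Dag.B13_main (leavesP w P) := by
  refine (b13_main_iff_res₅ F N θ w P hup).mpr fun h9 h10 h11 h12 => ?_
  rw [hS, hc]
  exact hleaf h9 h10 h11 h12

/-- The two record bindings agree on N10's own leaf: `(upOfRecord₅C θ P).b13 = (upOfRecord₅ θ P).b13` (`rfl`; they differ in `b10` only,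
`Node00.upOfRecord₅C_leaves`). [cite: Balaban1988RG2Cluster, Lemmas 1–3 pp.9, 11, 20 (bookkeeping)] -/
theorem b13_leaf_res₅C_eq_res₅ : (upOfRecord₅C F N θ P).b13 = (upOfRecord₅ F N θ P).b13 := rfl

end AtParams

/-! ## §2. At the record predicates `IsRecordOfRecord₅C` (of record) and `IsRecordOfRecord₅` (literal twin) -/

section AtRecord

variable {F N}
variable {D : FiniteEpsData F (SU N)} {w : WorldP}

/-- **N10 AT NODE 00's STAGE-5 RECORD OF RECORD, KNIT BY NAME** ([Balaban1988RG2Cluster] Lemmas 1–3 pp. 9, 11, 20; C-binding): if `(D, w)` is a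
record (`IsRecordOfRecord₅C F N D w`) and, for the parameters of the record — every admissible `θ` with `D = datumOfRecord₅ θ` and
`w.up = upOfRecord₅C θ` — every run carries the slot (B13₅) «in-edges at the residual carriers ⇒ the B13 triple of the residual group», then N10 holds
at every run.  Count-neutral slot landing. [cite: Balaban1988RG2Cluster, Lemmas 1–3 pp.9, 11, 20] -/
theorem b13_main_of_isRecordOfRecord₅C (h : IsRecordOfRecord₅C F N D w)
    (slots : ∀ θ : Stage5Params F N, θ.Admissible → D = datumOfRecord₅ F N θ →
      (∀ P, w.up P = upOfRecord₅C F N θ P) → ∀ P : B12.RunParams,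
        B9LeafX (θ.res.Y P) →
          (B10.Thm1PrintedCompact (θ.res.X P).runs10 ∧ B10.Thm2Printed (θ.res.X P).runs10) →
            B11Leaf (θ.res.Z P) → B12Sec2to5.Lemma4Printed (θ.res.X P).F12 (θ.res.X P).c12 →
              B13.Lemma1Printed (θ.res.X P).S13 (θ.res.X P).c13 ∧ B13.Lemma2Printed (θ.res.X P).S13 (θ.res.X P).c13 ∧
                B13.Lemma3Printed (θ.res.X P).S13 (θ.res.X P).c13) :
    ∀ P : B12.RunParams, Dag.B13_main (leavesP w P) := by
  intro P
  obtain ⟨θ, hθ, hD, -, -, -, hup⟩ := h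
  exact b13_main_at_stage5ParamsC F N θ w P (hup P) (slots θ hθ hD hup P)

/-- **The `S_N10 Rec₅C` shape**: `∀ D w, IsRecordOfRecord₅C F N D w → ∀ P, Dag.B13_main (leavesP w P)` from the slot (B13₅) stated ONCE over all
admissible parameters `θ` and runs `P` — the form a `stub_N10` typed over the Stage-5 record predicate of record takes (R422; dagwriter K3
`S_N10 := AtRecord Rec Dag.B13_main`).  The slot reads neither `D` nor `w`: N10 is a statement about the residual carriers `θ.res` alone, and at
Stage 5 those are FREE data — so the slot is a displayed hypothesis until a later stage pins `θ.res.X P` (e.g. by the torus datum of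
`b13_main_forall_isRecordOfRecord₅C_twoTorus`). [cite: Balaban1988RG2Cluster, Lemmas 1–3 pp.9, 11, 20] -/
theorem b13_main_forall_isRecordOfRecord₅C
    (slots : ∀ θ : Stage5Params F N, θ.Admissible → ∀ P : B12.RunParams,
      B9LeafX (θ.res.Y P) →
        (B10.Thm1PrintedCompact (θ.res.X P).runs10 ∧ B10.Thm2Printed (θ.res.X P).runs10) →
          B11Leaf (θ.res.Z P) → B12Sec2to5.Lemma4Printed (θ.res.X P).F12 (θ.res.X P).c12 →
            B13.Lemma1Printed (θ.res.X P).S13 (θ.res.X P).c13 ∧ B13.Lemma2Printed (θ.res.X P).S13 (θ.res.X P).c13 ∧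
              B13.Lemma3Printed (θ.res.X P).S13 (θ.res.X P).c13) :
    ∀ (D : FiniteEpsData F (SU N)) (w : WorldP), IsRecordOfRecord₅C F N D w →
      ∀ P : B12.RunParams, Dag.B13_main (leavesP w P) := by
  intro D w h P
  obtain ⟨θ, hθ, -, -, -, -, hup⟩ := h
  exact b13_main_at_stage5ParamsC F N θ w P (hup P) (slots θ hθ P)

/-- **The `S_N10 Rec₅C` shape FROM A FAMILY OF TORUS PINS**: if for every admissible `θ` and run `P` the residual B13 group IS the record of a
two-scale torus step datum `Wt θ P : TwoTorusStep 4 (L θ P) (N′ θ P)` with constants `c θ P` (`hS`, `hc`) whose leaf triple holds (`hleaf` —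
`B13NodeTorusTermwise.b13Leaf_twoTorus_termwise ∕ _primitives` per `(θ, P)`), then N10 holds at every run of every Stage-5 record of record
(in-edges unused, as in the torus chain: their content enters the chain's per-term inputs). [cite: Balaban1988RG2Cluster, Lemmas 1–3 pp.9, 11, 20] -/
theorem b13_main_forall_isRecordOfRecord₅C_twoTorus
    (L N' : Stage5Params F N → B12.RunParams → ℕ) [∀ θ P, NeZero (L θ P)] [∀ θ P, NeZero (N' θ P)]
    (Wt : (θ : Stage5Params F N) → (P : B12.RunParams) → TwoTorusStep 4 (L θ P) (N' θ P))
    (c : Stage5Params F N → B12.RunParams → B13.Consts)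
    (hS : ∀ θ : Stage5Params F N, θ.Admissible → ∀ P, (θ.res.X P).S13 = (Wt θ P).toStepData)
    (hc : ∀ θ : Stage5Params F N, θ.Admissible → ∀ P, (θ.res.X P).c13 = c θ P)
    (hleaf : ∀ θ : Stage5Params F N, θ.Admissible → ∀ P,
      B13.Lemma1Printed (Wt θ P).toStepData (c θ P) ∧ B13.Lemma2Printed (Wt θ P).toStepData (c θ P) ∧
        B13.Lemma3Printed (Wt θ P).toStepData (c θ P)) :
    ∀ (D : FiniteEpsData F (SU N)) (w : WorldP), IsRecordOfRecord₅C F N D w →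
      ∀ P : B12.RunParams, Dag.B13_main (leavesP w P) := by
  intro D w h P
  obtain ⟨θ, hθ, -, -, -, -, hup⟩ := h
  exact b13_main_at_stage5ParamsC_twoTorus F N θ w P (hup P) (Wt θ P) (c θ P) (hS θ hθ P) (hc θ hθ P)
    fun _ _ _ _ => hleaf θ hθ P

/-- **N10 at the literal-`b10` Stage-5 record, knit by name** (N-binding twin of `b13_main_of_isRecordOfRecord₅C`).
[cite: Balaban1988RG2Cluster, Lemmas 1–3 pp.9, 11, 20] -/
theorem b13_main_of_isRecordOfRecord₅ (h : IsRecordOfRecord₅ F N D w)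
    (slots : ∀ θ : Stage5Params F N, θ.Admissible → D = datumOfRecord₅ F N θ →
      (∀ P, w.up P = upOfRecord₅ F N θ P) → ∀ P : B12.RunParams,
        B9LeafX (θ.res.Y P) → (B10.Thm1Printed (θ.res.X P).runs10 ∧ B10.Thm2Printed (θ.res.X P).runs10) →
          B11Leaf (θ.res.Z P) → B12Sec2to5.Lemma4Printed (θ.res.X P).F12 (θ.res.X P).c12 →
            B13.Lemma1Printed (θ.res.X P).S13 (θ.res.X P).c13 ∧ B13.Lemma2Printed (θ.res.X P).S13 (θ.res.X P).c13 ∧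
              B13.Lemma3Printed (θ.res.X P).S13 (θ.res.X P).c13) :
    ∀ P : B12.RunParams, Dag.B13_main (leavesP w P) := by
  intro P
  obtain ⟨θ, hθ, hD, -, -, -, hup⟩ := h
  exact b13_main_at_stage5Params F N θ w P (hup P) (slots θ hθ hD hup P)

/-- **The `S_N10 Rec₅` shape** (literal twin of `b13_main_forall_isRecordOfRecord₅C`). [cite: Balaban1988RG2Cluster, Lemmas 1–3 pp.9, 11, 20] -/
theorem b13_main_forall_isRecordOfRecord₅
    (slots : ∀ θ : Stage5Params F N, θ.Admissible → ∀ P : B12.RunParams,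
      B9LeafX (θ.res.Y P) → (B10.Thm1Printed (θ.res.X P).runs10 ∧ B10.Thm2Printed (θ.res.X P).runs10) →
        B11Leaf (θ.res.Z P) → B12Sec2to5.Lemma4Printed (θ.res.X P).F12 (θ.res.X P).c12 →
          B13.Lemma1Printed (θ.res.X P).S13 (θ.res.X P).c13 ∧ B13.Lemma2Printed (θ.res.X P).S13 (θ.res.X P).c13 ∧
            B13.Lemma3Printed (θ.res.X P).S13 (θ.res.X P).c13) :
    ∀ (D : FiniteEpsData F (SU N)) (w : WorldP), IsRecordOfRecord₅ F N D w →
      ∀ P : B12.RunParams, Dag.B13_main (leavesP w P) := by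
  intro D w h P
  obtain ⟨θ, hθ, -, -, -, -, hup⟩ := h
  exact b13_main_at_stage5Params F N θ w P (hup P) (slots θ hθ P)

/-- **The two Stage-5 record predicates carry the same N10 verdict whenever the in-edges are not used**: a slot giving the residual B13 triple
outright serves both `IsRecordOfRecord₅C` and `IsRecordOfRecord₅` (their `b13` leaves coincide, `b13_leaf_res₅C_eq_res₅`).
[cite: Balaban1988RG2Cluster, Lemmas 1–3 pp.9, 11, 20 (bookkeeping)] -/
theorem b13_main_forall_both_records
    (slots : ∀ θ : Stage5Params F N, θ.Admissible → ∀ P : B12.RunParams,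
      B13.Lemma1Printed (θ.res.X P).S13 (θ.res.X P).c13 ∧ B13.Lemma2Printed (θ.res.X P).S13 (θ.res.X P).c13 ∧
        B13.Lemma3Printed (θ.res.X P).S13 (θ.res.X P).c13) :
    (∀ (D : FiniteEpsData F (SU N)) (w : WorldP), IsRecordOfRecord₅C F N D w →
        ∀ P : B12.RunParams, Dag.B13_main (leavesP w P)) ∧
      ∀ (D : FiniteEpsData F (SU N)) (w : WorldP), IsRecordOfRecord₅ F N D w →
        ∀ P : B12.RunParams, Dag.B13_main (leavesP w P) :=
  ⟨b13_main_forall_isRecordOfRecord₅C fun θ hθ P _ _ _ _ => slots θ hθ P,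
    b13_main_forall_isRecordOfRecord₅ fun θ hθ P _ _ _ _ => slots θ hθ P⟩

end AtRecord

/-! ## §3. Termwise domination (2.9)/(2.14) from the equality form -/

open Classical in
/-- **(2.9)/(2.14) pp. 14–15 in EQUALITY form implies termwise domination**: if on the space of p. 15 the activity of the two-scale torus step IS the
sum of its terms (𝐃, P) — p. 14: *"H(Z) = Σ_{Z₀: Z₀ᶜ = Z} H(Z, Z₀). (2.9) … The activities H(Z) are sums of many terms, more exactly the sums in
(2.9), (2.1), (2.3) over Z₀, 𝐃, P"* — then `‖H(Z)φ‖ ≤ Σ_t ‖T_t(Z)φ‖` (`B13Lemma3TorusSocket.TermDomination`, the hypothesis `hH` of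
`B13NodeTorusTermwise.b13Leaf_twoTorus_termwise ∕ _primitives`) by the triangle inequality; for a pin whose `H` is the displayed sum this discharges
`hH`. [cite: Balaban1988RG2Cluster, (2.9) p.14 and (2.14) p.15] -/
theorem termDomination_of_repr {L N' : ℕ} [NeZero L] [NeZero N'] (M : ℕ) [NeZero M] (W : TwoTorusStep 4 L N')
    (T : (Z : TDom 4 N') → Finset (TDom 4 (L * N')) × Finset (TBond 4 M (L * N')) → W.Φ → ℂ)
    (hH : ∀ (Z : TDom 4 N') (φ : W.Φ), φ ∈ W.sp2 Z → W.H Z φ = ∑ t ∈ terms L M Z, T Z t φ) :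
    TermDomination M W T := by
  intro Z φ hφ
  rw [hH Z φ hφ]
  exact norm_sum_le _ _

open Classical in
/-- The equality form, pointwise variant: `H(Z) = Σ_t T_t(Z)` as functions on the configurations (no space restriction) ⇒ `TermDomination`.
[cite: Balaban1988RG2Cluster, (2.9) p.14 and (2.14) p.15] -/
theorem termDomination_of_eq {L N' : ℕ} [NeZero L] [NeZero N'] (M : ℕ) [NeZero M] (W : TwoTorusStep 4 L N')
    (T : (Z : TDom 4 N') → Finset (TDom 4 (L * N')) × Finset (TBond 4 M (L * N')) → W.Φ → ℂ)
    (hH : ∀ (Z : TDom 4 N') (φ : W.Φ), W.H Z φ = ∑ t ∈ terms L M Z, T Z t φ) :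
    TermDomination M W T :=
  termDomination_of_repr M W T fun Z φ _ => hH Z φ

end Literature.MathematicalPhysics.QuantumFieldTheory.Balaban1983to89.B13NodeKnitRecord5C

end
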